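import Summits.ResolutionOfSingularities.ResolutionOfSingularities.Theorems.FrobeniusClosingPatchingRelPerfectDepthHSepCJS
import Summits.ResolutionOfSingularities.ResolutionOfSingularities.Theorems.FrobeniusClosingPatchingRelPerfectDepthOneRegularizeSupportEnd
import Literature.AlgebraicGeometry.Resolution.TransversalUnionSNC
import Literature.AlgebraicGeometry.Resolution.StrictNormalCrossingsHasSNC
import Literature.AlgebraicGeometry.Resolution.EtaleVanishingIdeal
import Literature.AlgebraicGeometry.Resolution.DivisorialPart
import Literature.AlgebraicGeometry.Resolution.BlowupsLocal
import Literature.AlgebraicGeometry.Resolution.BlowupChartMembership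
import Literature.AlgebraicGeometry.Resolution.KollarMaxContactPersistence
import Literature.AlgebraicGeometry.Resolution.KollarTripleBlowup
import HarnessLib

/-!
# Crux `PatchingRelPerfect` (stmt-ResolutionOfSingularities-16161), chain W5.2 — rung R5ᴴ, hand N4 «END components»:
# ONE simple-normal-crossings family of prime divisors presenting every member of the CJS end state

[OURS · L1 W5.2 · R5ᴴ N4 (owner res-D-pv-055, targets `…DepthTargetsR5H` p535426; hand res-D-pv-054; consumer N5
`…DepthHSepPeel`, res-D-pv-016 AS stub-5)] Fact-free except the named antecedent `CossartJannsenSaito2020EmbeddedSequenceB`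
(F-32bR) of the last two theorems; NOT statements of the manuscript under review (Hironaka 2017); AI-written, weaker than
expert review.

From the END clauses of N3 (`HSepCJS.transport_of_cjsB`: `W₁ ≅ Z₁` regular, `X₁` closed and transversal to the strict
normal crossings divisor `B₁`, the member `D₁` and the exceptional members `ℰ₁` effective Cartier with
`e⁻¹X₁ ⊆ Supp D₁ ⊆ e⁻¹X₁ ∪ ⋃ Supp ℰ₁`, the `ℰ₁` drawn on `e⁻¹B₁` and covering it):
* `isStrictNormalCrossingsDivisor_union_end` — `X₁ ∪ B₁` is a strict normal crossings divisor on `Z₁`: it is the support of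
  the effective Cartier divisor `D₁ · Π boundaryOf ℰ₁` pushed along `e`, so `IsTransversalWith.isStrictNormalCrossingsDivisor_union`
  applies (its radical clause);
* `exists_end_family` — ONE list `𝓔` of ideal sheaves on `W₁` with simple normal crossings, each the (prime) ideal of an
  irreducible closed subset, with `⋃ Supp 𝓔 = e⁻¹(X₁ ∪ B₁)` and containing the ideal of the closure of every maximal point of
  `e⁻¹(X₁ ∪ B₁)` (Stacks 0BIA (2) ⇒ (1), `IsStrictNormalCrossingsDivisor.exists_hasSNC` on `Z₁`, pulled back along `e`);
* `exists_factors_of_support_subset` — an effective Cartier divisor on a regular integral Noetherian scheme whose support lies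
  in a strict normal crossings divisor `S` is a MONOMIAL in the ideals of the components of `S` (its divisorial part,
  Cossart–Piltant 2008, proof of Prop. 4.2; the codimension-one points of its support are maximal points of `S`);
* `end_components`, `components_of_cjsB` — the N4 EXPORT: an `HSepSeq` from `[(D, ℓ)]` to a list `𝒟₁` on a regular `W₁`
  together with ONE snc family `𝓔` (irreducible supports, no unit member) such that EVERY member of `𝒟₁` is effective
  Cartier and equals `monomialIdeal q` for a list `q` of factors taken from `𝓔`.

## References
* V. Cossart, U. Jannsen, S. Saito, LNM 2270 (2020), Thm. 1.4, Def. 4.1, p. 7. [CossartJannsenSaito2020]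
* V. Cossart, O. Piltant, J. Algebra 320 (2008), proof of Prop. 4.2. [CossartPiltant2008]
* J. Kollár, *Lectures on Resolution of Singularities* (2007), (3.111) Step 3. [Kollar2007]
* The Stacks Project, Tags 0BIA, 0BE1. [StacksProject]
-/

-- `Summit.<Summit>.<Sub>.Theorems` with `Sub = Summit` (single-conjunct summit, D-0017)
set_option linter.dupNamespace false

noncomputable section

open CategoryTheory CategoryTheory.Limits AlgebraicGeometry TopologicalSpace IsLocalRing
open Literature.AlgebraicGeometry.Resolution Scheme.IdealSheafData

namespace Summit.ResolutionOfSingularities.ResolutionOfSingularities.Theorems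

universe u

namespace HSepCJS

open DepthTargets WeightTwoB

/-! ## §1 Small tools: products of effective Cartier divisors, maximal points under homeomorphisms -/

/-- A finite product of effective Cartier ideal sheaves is effective Cartier. [folklore] -/
theorem isEffectiveCartier_prod {X : Scheme.{u}} {L : List X.IdealSheafData} (h : ∀ K ∈ L, IsEffectiveCartier K) :
    IsEffectiveCartier L.prod := by
  induction L with
  | nil => rw [List.prod_nil, Scheme.IdealSheafData.one_eq_top]; exact isEffectiveCartier_top
  | cons K L ih =>
    rw [List.prod_cons]
    exact (h K List.mem_cons_self).mul (ih fun K' hK' => h K' (List.mem_cons_of_mem _ hK'))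

/-- The support of a finite product of ideal sheaves is the union of the supports. [folklore] -/
theorem mem_support_prod_iff {X : Scheme.{u}} {L : List X.IdealSheafData} {x : X} :
    x ∈ L.prod.support ↔ ∃ K ∈ L, x ∈ K.support := by
  induction L with
  | nil =>
    rw [List.prod_nil, Scheme.IdealSheafData.one_eq_top, Scheme.IdealSheafData.support_top]
    change x ∈ ((⊥ : Closeds X) : Set X) ↔ _
    rw [Closeds.coe_bot]
    simp
  | cons K L ih =>
    rw [List.prod_cons, Scheme.IdealSheafData.support_mul]
    change x ∈ (K.support : Set X) ∪ (L.prod.support : Set X) ↔ _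
    rw [Set.mem_union]
    constructor
    · rintro (hx | hx)
      · exact ⟨K, List.mem_cons_self, hx⟩
      · obtain ⟨K', hK', hx'⟩ := ih.mp hx
        exact ⟨K', List.mem_cons_of_mem _ hK', hx'⟩
    · rintro ⟨K', hK', hx'⟩
      rcases List.mem_cons.mp hK' with rfl | hK'
      · exact Or.inl hx'
      · exact Or.inr (ih.mpr ⟨K', hK', hx'⟩)

/-- Maximal points are transported by homeomorphisms: `η` is a maximal point of `h⁻¹ Z` iff `h η` is a maximal point of
`Z`. [folklore] -/
theorem mem_maxPoints_preimage_iff {α β : Type*} [TopologicalSpace α] [TopologicalSpace β] (h : α ≃ₜ β) {Z : Set β}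
    {η : α} : η ∈ maxPoints (h ⁻¹' Z) ↔ h η ∈ maxPoints Z := by
  rw [mem_maxPoints_iff, mem_maxPoints_iff, Set.mem_preimage]
  refine ⟨fun ⟨hηZ, hmax⟩ => ⟨hηZ, fun η' hη' hsp => ?_⟩, fun ⟨hηZ, hmax⟩ => ⟨hηZ, fun η' hη' hsp => ?_⟩⟩
  · have h1 : h.symm η' ⤳ η := by
      have h2 := hsp.map h.symm.continuous
      rwa [h.symm_apply_apply] at h2
    have h3 : h.symm η' = η := hmax (h.symm η') (by rw [Set.mem_preimage, h.apply_symm_apply]; exact hη') h1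
    rw [← h3, h.apply_symm_apply]
  · have h3 : h η' = h η := hmax (h η') hη' (hsp.map h.continuous)
    exact h.injective h3

/-- The preimage of the closure of a point under a homeomorphism is the closure of the preimage point. [folklore] -/
theorem preimage_closure_singleton {α β : Type*} [TopologicalSpace α] [TopologicalSpace β] (h : α ≃ₜ β) (y : β) :
    h ⁻¹' closure {y} = closure {h.symm y} := by
  rw [h.preimage_closure, ← Set.image_singleton, ← h.image_symm, Set.image_singleton]

/-- A regular scheme stays regular across an isomorphism. [folklore] -/
theorem isRegular_of_iso {W₁ Z₁ : Scheme.{u}} (e : W₁ ≅ Z₁) (hW₁ : Scheme.IsRegular W₁) : Scheme.IsRegular Z₁ := by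
  intro y
  haveI := hW₁ (e.inv y)
  exact IsRegularLocalRing.of_ringEquiv (asIso (e.inv.stalkMap y)).commRingCatIsoToRingEquiv

/-! ## §2 `X₁ ∪ B₁` is a strict normal crossings divisor -/

section End

variable {W₁ Z₁ : Scheme.{u}} (e : W₁ ≅ Z₁) {X₁ B₁ : Set Z₁} {D₁ : W₁.IdealSheafData}
  {ℰ₁ : List (W₁.IdealSheafData × ℕ)}

/-- **The total divisor of the end state**: `M := D₁ · Π boundaryOf ℰ₁` has support `e⁻¹(X₁ ∪ B₁)`. [folklore] -/
theorem mem_support_totalDivisor_iff (hlow : e.hom ⁻¹' X₁ ⊆ (D₁.support : Set W₁))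
    (hup : (D₁.support : Set W₁) ⊆ e.hom ⁻¹' X₁ ∪ ⋃ p ∈ ℰ₁, (p.1.support : Set W₁))
    (hbd : ∀ p ∈ ℰ₁, (p.1.support : Set W₁) ⊆ e.hom ⁻¹' B₁)
    (hcov : ∀ x : W₁, e.hom x ∈ B₁ → ∃ p ∈ ℰ₁, x ∈ p.1.support) (x : W₁) :
    x ∈ (D₁ * (boundaryOf ℰ₁).prod).support ↔ e.hom x ∈ X₁ ∪ B₁ := by
  rw [Scheme.IdealSheafData.support_mul]
  change x ∈ (D₁.support : Set W₁) ∪ ((boundaryOf ℰ₁).prod.support : Set W₁) ↔ _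
  rw [Set.mem_union]
  constructor
  · rintro (hx | hx)
    · rcases hup hx with h | h
      · exact Or.inl h
      · obtain ⟨p, hp, hxp⟩ := Set.mem_iUnion₂.mp h
        exact Or.inr (hbd p hp hxp)
    · obtain ⟨K, hK, hxK⟩ := mem_support_prod_iff.mp hx
      obtain ⟨p, hp, rfl⟩ := List.mem_map.mp hK
      exact Or.inr (hbd p hp hxK)
  · rintro (hx | hx)
    · exact Or.inl (hlow hx)
    · obtain ⟨p, hp, hxp⟩ := hcov x hx
      exact Or.inr (mem_support_prod_iff.mpr ⟨p.1, List.mem_map.mpr ⟨p, hp, rfl⟩, hxp⟩)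

/-- **`X₁ ∪ B₁` is a strict normal crossings divisor on `Z₁`** (the END clause CJS state on p. 7 / CP 2019 "we get (iii)"):
`X₁` is closed and transversal to the sncd `B₁`, and `X₁ ∪ B₁` is the support of the effective Cartier divisor
`(D₁ · Π boundaryOf ℰ₁)` pushed along `e : W₁ ≅ Z₁`, so at every point its ideal is the radical of a non-zero principal ideal
(`IsTransversalWith.isStrictNormalCrossingsDivisor_union`). [cite: CossartJannsenSaito2020, Def. 4.1, Thm. 1.4]
[cite: StacksProject, Tag 0BIA] -/
theorem isStrictNormalCrossingsDivisor_union_end [IsLocallyNoetherian W₁] (hD₁ : IsEffectiveCartier D₁)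
    (hℰ₁ : HasSNC (boundaryOf ℰ₁)) (hX₁c : IsClosed X₁) (htr : IsTransversalWith Z₁ X₁ B₁)
    (hB₁ : IsStrictNormalCrossingsDivisor Z₁ B₁) (hlow : e.hom ⁻¹' X₁ ⊆ (D₁.support : Set W₁))
    (hup : (D₁.support : Set W₁) ⊆ e.hom ⁻¹' X₁ ∪ ⋃ p ∈ ℰ₁, (p.1.support : Set W₁))
    (hbd : ∀ p ∈ ℰ₁, (p.1.support : Set W₁) ⊆ e.hom ⁻¹' B₁)
    (hcov : ∀ x : W₁, e.hom x ∈ B₁ → ∃ p ∈ ℰ₁, x ∈ p.1.support) :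
    IsStrictNormalCrossingsDivisor Z₁ (X₁ ∪ B₁) := by
  set M : W₁.IdealSheafData := D₁ * (boundaryOf ℰ₁).prod with hMdef
  have hM : IsEffectiveCartier M :=
    hD₁.mul (isEffectiveCartier_prod fun K hK => hℰ₁.isEffectiveCartier_of_mem hK)
  -- push `M` along `e`
  have hN : IsEffectiveCartier (M.comap e.inv) := hM.comap_iso e.symm
  have hNsupp : ((M.comap e.inv).support : Set Z₁) = X₁ ∪ B₁ := by
    ext y
    rw [Scheme.IdealSheafData.support_comap, Closeds.coe_preimage, Set.mem_preimage, SetLike.mem_coe,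
      mem_support_totalDivisor_iff e hlow hup hbd hcov, hom_inv_apply]
  have hcl : (⟨closure (X₁ ∪ B₁), isClosed_closure⟩ : Closeds Z₁) = (M.comap e.inv).support := by
    apply Closeds.ext
    change closure (X₁ ∪ B₁) = ((M.comap e.inv).support : Set Z₁)
    rw [(hX₁c.union hB₁.isClosed).closure_eq, hNsupp]
  refine htr.isStrictNormalCrossingsDivisor_union hB₁ hX₁c fun y _ => ?_
  obtain ⟨t, ht, hst⟩ := hN.exists_stalkIdeal_eq_span y
  refine ⟨t, nonZeroDivisors.ne_zero ht, ?_⟩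
  rw [hcl, vanishingIdeal_support, stalkIdeal_radical, hst]

/-! ## §3 ONE simple-normal-crossings family of prime divisors on `W₁` -/

/-- **The END family.** On `W₁ ≅ Z₁` with the END clauses there is ONE list `𝓔` of ideal sheaves with simple normal crossings,
each the ideal `𝓘(cl{ζ})` of an irreducible closed subset (so `≠ ⊤`, with irreducible support `cl{ζ}`), whose supports cover
exactly `e⁻¹(X₁ ∪ B₁)`, and containing `𝓘(cl{ζ})` for every maximal point `ζ` of `e⁻¹(X₁ ∪ B₁)`: the component ideals of the
sncd `X₁ ∪ B₁` (`IsStrictNormalCrossingsDivisor.exists_hasSNC`, Stacks 0BIA (2) ⇒ (1)) pulled back along `e`.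
[cite: StacksProject, Tag 0BIA] [cite: BierstoneGrigorievMilmanWlodarczyk2011, Def. 3.1.1] -/
theorem exists_end_family [IsNoetherian W₁] [IsNoetherian Z₁] (hW₁ : Scheme.IsRegular W₁) (hD₁ : IsEffectiveCartier D₁)
    (hℰ₁ : HasSNC (boundaryOf ℰ₁)) (hX₁c : IsClosed X₁) (htr : IsTransversalWith Z₁ X₁ B₁)
    (hB₁ : IsStrictNormalCrossingsDivisor Z₁ B₁) (hlow : e.hom ⁻¹' X₁ ⊆ (D₁.support : Set W₁))
    (hup : (D₁.support : Set W₁) ⊆ e.hom ⁻¹' X₁ ∪ ⋃ p ∈ ℰ₁, (p.1.support : Set W₁))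
    (hbd : ∀ p ∈ ℰ₁, (p.1.support : Set W₁) ⊆ e.hom ⁻¹' B₁)
    (hcov : ∀ x : W₁, e.hom x ∈ B₁ → ∃ p ∈ ℰ₁, x ∈ p.1.support) :
    ∃ 𝓔 : List W₁.IdealSheafData, HasSNC 𝓔 ∧
      (∀ T ∈ 𝓔, ∃ ζ : W₁, T = vanishingIdeal ⟨closure {ζ}, isClosed_closure⟩) ∧
      (∀ T ∈ 𝓔, IsIrreducible (T.support : Set W₁)) ∧ (∀ T ∈ 𝓔, T ≠ ⊤) ∧
      (⋃ T ∈ 𝓔, (T.support : Set W₁)) = e.hom ⁻¹' (X₁ ∪ B₁) ∧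
      (∀ ζ ∈ maxPoints (e.hom ⁻¹' (X₁ ∪ B₁)), vanishingIdeal ⟨closure {ζ}, isClosed_closure⟩ ∈ 𝓔) := by
  have hsnc := isStrictNormalCrossingsDivisor_union_end e hD₁ hℰ₁ hX₁c htr hB₁ hlow hup hbd hcov
  obtain ⟨Es, hEs, hEsmax, hmaxEs, hU⟩ := hsnc.exists_hasSNC (isRegular_of_iso e hW₁)
  -- the homeomorphism underlying `e`
  let h : W₁ ≃ₜ Z₁ := Scheme.homeoOfIso e
  have hh : ∀ x, h x = e.hom x := fun x => rfl
  have hhs : ∀ y, h.symm y = e.inv y := fun y => rfl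
  -- pull back a component ideal
  have hpull : ∀ η : Z₁, (vanishingIdeal ⟨closure {η}, isClosed_closure⟩ : Z₁.IdealSheafData).comap e.hom =
      vanishingIdeal ⟨closure {e.inv η}, isClosed_closure⟩ := by
    intro η
    rw [comap_hom_vanishingIdeal]
    congr 1
    apply Closeds.ext
    change e.hom ⁻¹' closure {η} = closure {e.inv η}
    have h1 := preimage_closure_singleton h η
    rwa [hhs] at h1
  refine ⟨Es.map (·.comap e.hom), ?_, fun T hT => ?_, fun T hT => ?_, fun T hT => ?_, ?_, fun ζ hζ => ?_⟩
  · have h1 := hEs.comap_of_isOpenImmersion e.hom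
    rwa [Scheme.IdealSheafData.comap_top] at h1
  · obtain ⟨G, hG, rfl⟩ := List.mem_map.mp hT
    obtain ⟨η, -, rfl⟩ := hEsmax G hG
    exact ⟨e.inv η, hpull η⟩
  · obtain ⟨G, hG, rfl⟩ := List.mem_map.mp hT
    obtain ⟨η, -, rfl⟩ := hEsmax G hG
    rw [hpull η, Scheme.IdealSheafData.coe_support_vanishingIdeal]
    exact isIrreducible_singleton.closure
  · obtain ⟨G, hG, rfl⟩ := List.mem_map.mp hT
    obtain ⟨η, -, rfl⟩ := hEsmax G hG
    rw [hpull η]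
    intro htop
    have h1 : e.inv η ∈ ((vanishingIdeal ⟨closure {e.inv η}, isClosed_closure⟩ : W₁.IdealSheafData).support : Set W₁) := by
      rw [Scheme.IdealSheafData.coe_support_vanishingIdeal]
      exact subset_closure (Set.mem_singleton _)
    rw [htop, Scheme.IdealSheafData.support_top] at h1
    exact h1
  · ext x
    simp only [List.mem_map, Set.mem_iUnion, exists_prop]
    constructor
    · rintro ⟨T, ⟨G, hG, rfl⟩, hxT⟩
      rw [SetLike.mem_coe, Scheme.IdealSheafData.support_comap] at hxT
      change e.hom x ∈ (G.support : Set Z₁) at hxT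
      rw [← hU]
      exact Set.mem_iUnion₂.mpr ⟨G, hG, hxT⟩
    · intro hx
      rw [Set.mem_preimage, ← hU] at hx
      obtain ⟨G, hG, hxG⟩ := Set.mem_iUnion₂.mp hx
      refine ⟨G.comap e.hom, ⟨G, hG, rfl⟩, ?_⟩
      rw [SetLike.mem_coe, Scheme.IdealSheafData.support_comap]
      exact hxG
  · have h1 : h ζ ∈ maxPoints (X₁ ∪ B₁) := (mem_maxPoints_preimage_iff h).mp hζ
    rw [hh] at h1
    have h2 := hmaxEs _ h1
    refine List.mem_map.mpr ⟨_, h2, ?_⟩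
    rw [hpull, inv_hom_apply]

end End

/-! ## §4 Effective Cartier divisors supported in a strict normal crossings divisor are monomials in its components -/

/-- An effective Cartier ideal sheaf on an integral locally Noetherian scheme is not the zero ideal. [folklore] -/
theorem ne_bot_of_isEffectiveCartier {W : Scheme.{u}} [IsIntegral W] [IsLocallyNoetherian W]
    {M : W.IdealSheafData} (hM : IsEffectiveCartier M) : M ≠ ⊥ := by
  intro h
  have h1 := hM.dense_compl_support.nonempty
  rw [h, Scheme.IdealSheafData.support_bot] at h1
  obtain ⟨x, hx⟩ := h1
  exact hx trivial

/-- **An effective Cartier divisor supported in a strict normal crossings divisor `S` is a monomial in the components of `S`**: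
on a regular integral Noetherian scheme, `M = ∏_ζ 𝓘(cl{ζ})^{ord_ζ M}` over the codimension-one points `ζ` of `V(M)`
(Cossart–Piltant 2008, proof of Prop. 4.2: `M` is its own divisorial part, the cofactor being the unit ideal for `M` locally
principal — tree `DivisorialPart.lean`), and these `ζ` are maximal points of `S` (`DepthOne.mem_maxPoints_of_coheight_eq_one`);
so the factors may be taken from ANY list `𝓔` containing the ideals of the components of `S`.
[cite: CossartPiltant2008, proof of Prop. 4.2] [cite: StacksProject, Tag 0BE1] -/
theorem exists_factors_of_support_subset (W : Scheme.{u}) [IsIntegral W] [IsNoetherian W] (hW : Scheme.IsRegular W)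
    {S : Set W} (hS : IsStrictNormalCrossingsDivisor W S) {𝓔 : List W.IdealSheafData}
    (hmem : ∀ ζ ∈ maxPoints S, vanishingIdeal ⟨closure {ζ}, isClosed_closure⟩ ∈ 𝓔) (M : W.IdealSheafData)
    (hM : IsEffectiveCartier M) (hsupp : (M.support : Set W) ⊆ S) :
    ∃ q : List (W.IdealSheafData × ℕ), (∀ f ∈ q, f.1 ∈ 𝓔) ∧ M = monomialIdeal q := by
  classical
  have hMne : M ≠ ⊥ := ne_bot_of_isEffectiveCartier hM
  have hfin : (divisorialPoints M).Finite := finite_divisorialPoints hMne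
  -- `M` is its own divisorial part
  have hJ : codimTwoPart M = ⊤ := (isLocallyPrincipal_iff_codimTwoPart_eq_top hW hMne).mp hM.isLocallyPrincipal
  have hMeq : M = ∏ ζ ∈ hfin.toFinset, primeDivisorIdeal ζ ^ (idealOrder M ζ).toNat := by
    have h := divisorialPart_mul_codimTwoPart hW hMne
    rw [hJ, Scheme.IdealSheafData.mul_top, divisorialPart_eq hfin] at h
    exact h.symm
  refine ⟨hfin.toFinset.toList.map fun ζ => (primeDivisorIdeal ζ, (idealOrder M ζ).toNat), fun f hf => ?_, ?_⟩
  · obtain ⟨ζ, hζ, rfl⟩ := List.mem_map.mp hf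
    rw [Finset.mem_toList, Set.Finite.mem_toFinset, mem_divisorialPoints_iff] at hζ
    exact hmem ζ (DepthOne.mem_maxPoints_of_coheight_eq_one hS hζ.2 (hsupp hζ.1))
  · rw [monomialIdeal, List.map_map, Finset.prod_map_toList]
    exact hMeq

/-! ## §5 The N4 EXPORT -/

section Export

variable {W₁ Z₁ : Scheme.{u}} (e : W₁ ≅ Z₁) {X₁ B₁ : Set Z₁} {D₁ : W₁.IdealSheafData}
  {ℰ₁ : List (W₁.IdealSheafData × ℕ)}

/-- **N4, END COMPONENTS (from the END clauses).** On `W₁ ≅ Z₁` with the END clauses of `HSepCJS.transport_of_cjsB`, there is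
ONE family `𝓔` with simple normal crossings, irreducible supports and no unit member, such that the host member `D₁` and every
exceptional member of `ℰ₁` is effective Cartier, supported in `⋃ Supp 𝓔 = e⁻¹(X₁ ∪ B₁)`, and equal to `monomialIdeal q` for a
list `q` of factors from `𝓔`. [cite: CossartJannsenSaito2020, Thm. 1.4] [cite: Kollar2007, (3.111) Step 3]
[cite: StacksProject, Tag 0BIA] -/
theorem end_components [IsIntegral W₁] [IsNoetherian W₁] [IsNoetherian Z₁] (hW₁ : Scheme.IsRegular W₁)
    (hD₁ : IsEffectiveCartier D₁) (hℰ₁ : HasSNC (boundaryOf ℰ₁)) (hX₁c : IsClosed X₁) (htr : IsTransversalWith Z₁ X₁ B₁)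
    (hB₁ : IsStrictNormalCrossingsDivisor Z₁ B₁) (hlow : e.hom ⁻¹' X₁ ⊆ (D₁.support : Set W₁))
    (hup : (D₁.support : Set W₁) ⊆ e.hom ⁻¹' X₁ ∪ ⋃ p ∈ ℰ₁, (p.1.support : Set W₁))
    (hbd : ∀ p ∈ ℰ₁, (p.1.support : Set W₁) ⊆ e.hom ⁻¹' B₁)
    (hcov : ∀ x : W₁, e.hom x ∈ B₁ → ∃ p ∈ ℰ₁, x ∈ p.1.support) (ℓ : ℕ) :
    ∃ 𝓔 : List W₁.IdealSheafData, HasSNC 𝓔 ∧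
      (∀ T ∈ 𝓔, ∃ ζ : W₁, T = vanishingIdeal ⟨closure {ζ}, isClosed_closure⟩) ∧
      (∀ T ∈ 𝓔, IsIrreducible (T.support : Set W₁)) ∧ (∀ T ∈ 𝓔, T ≠ ⊤) ∧
      (⋃ T ∈ 𝓔, (T.support : Set W₁)) = e.hom ⁻¹' (X₁ ∪ B₁) ∧
      (∀ p ∈ (D₁, ℓ) :: ℰ₁, IsEffectiveCartier p.1 ∧ (p.1.support : Set W₁) ⊆ e.hom ⁻¹' (X₁ ∪ B₁) ∧
        ∃ q : List (W₁.IdealSheafData × ℕ), (∀ f ∈ q, f.1 ∈ 𝓔) ∧ p.1 = monomialIdeal q) := by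
  obtain ⟨𝓔, h𝓔, hprime, hirr, hne, hU, hmax⟩ := exists_end_family e hW₁ hD₁ hℰ₁ hX₁c htr hB₁ hlow hup hbd hcov
  -- the sncd `e⁻¹(X₁ ∪ B₁)` on `W₁`
  have hS : IsStrictNormalCrossingsDivisor W₁ (e.hom ⁻¹' (X₁ ∪ B₁)) :=
    (isStrictNormalCrossingsDivisor_union_end e hD₁ hℰ₁ hX₁c htr hB₁ hlow hup hbd hcov).preimage_of_etale e.hom
  -- every member is effective Cartier with support over `X₁ ∪ B₁`
  have hmem : ∀ p ∈ (D₁, ℓ) :: ℰ₁, IsEffectiveCartier p.1 ∧ (p.1.support : Set W₁) ⊆ e.hom ⁻¹' (X₁ ∪ B₁) := by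
    intro p hp
    rcases List.mem_cons.mp hp with rfl | hp
    · refine ⟨hD₁, fun x hx => ?_⟩
      exact (mem_support_totalDivisor_iff e hlow hup hbd hcov x).mp (by
        rw [Scheme.IdealSheafData.support_mul]
        exact Or.inl hx)
    · exact ⟨hℰ₁.isEffectiveCartier_of_mem (List.mem_map.mpr ⟨p, hp, rfl⟩),
        (hbd p hp).trans (Set.preimage_mono Set.subset_union_right)⟩
  refine ⟨𝓔, h𝓔, hprime, hirr, hne, hU, fun p hp => ⟨(hmem p hp).1, (hmem p hp).2, ?_⟩⟩
  exact exists_factors_of_support_subset W₁ hW₁ hS hmax p.1 (hmem p hp).1 (hmem p hp).2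

end Export

/-- [OURS · L1 W5.2 · R5ᴴ N4] **CJS ⇒ HSepSeq with END COMPONENTS** (MODULO F-32bR = `CossartJannsenSaito2020EmbeddedSequenceB`,
a named antecedent): on an integral Noetherian regular excellent scheme `W` of dimension three, every effective Cartier `D`
with `ℓ ≥ 1` is carried by an `HSepSeq` from `[(D, ℓ)]` to a list `𝒟₁` on an integral Noetherian regular `W₁` carrying ONE
family `𝓔` of ideal sheaves with simple normal crossings, irreducible supports and no unit member, such that EVERY member of
`𝒟₁` is effective Cartier and equals `monomialIdeal q` for a list `q` of factors from `𝓔` — the input of the PEEL (N5).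
[cite: CossartJannsenSaito2020, Thm. 1.4] [cite: Kollar2007, (3.111) Step 3] [cite: StacksProject, Tag 0BIA] -/
theorem components_of_cjsB (hCJS : CossartJannsenSaito2020EmbeddedSequenceB.{u}) (W : Scheme.{u}) [IsIntegral W]
    [IsNoetherian W] (hreg : Scheme.IsRegular W) (hexc : Scheme.IsExcellent W) (hdim : topologicalKrullDim W = 3)
    (D : W.IdealSheafData) (hD : IsEffectiveCartier D) (ℓ : ℕ) (hℓ : 1 ≤ ℓ) :
    ∃ (W₁ : Scheme.{u}) (ρ : W₁ ⟶ W) (_ : IsIntegral W₁) (_ : IsNoetherian W₁) (𝒟₁ : List (W₁.IdealSheafData × ℕ))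
      (𝓔 : List W₁.IdealSheafData),
      HSepSeq ρ [(D, ℓ)] 𝒟₁ ∧ Scheme.IsRegular W₁ ∧ HasSNC 𝓔 ∧
      (∀ T ∈ 𝓔, ∃ ζ : W₁, T = vanishingIdeal ⟨closure {ζ}, isClosed_closure⟩) ∧
      (∀ T ∈ 𝓔, IsIrreducible (T.support : Set W₁)) ∧ (∀ T ∈ 𝓔, T ≠ ⊤) ∧
      (∀ p ∈ 𝒟₁, IsEffectiveCartier p.1 ∧ ((p.1.support : Set W₁) ⊆ ⋃ T ∈ 𝓔, (T.support : Set W₁)) ∧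
        ∃ q : List (W₁.IdealSheafData × ℕ), (∀ f ∈ q, f.1 ∈ 𝓔) ∧ p.1 = monomialIdeal q) := by
  obtain ⟨W₁, Z₁, ρ, hint, hnoeth, hnoethZ, e, X₁, B₁, D₁, ℰ₁, hseq, hW₁, hD₁, hℰ₁, hX₁c, -, htr, hB₁, hlow, hup, hbd,
    hcov⟩ := transport_of_cjsB hCJS W hreg hexc hdim D hD ℓ hℓ
  obtain ⟨𝓔, h𝓔, hprime, hirr, hne, hU, hmem⟩ :=
    end_components e hW₁ hD₁ hℰ₁ hX₁c htr hB₁ hlow hup hbd hcov ℓ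
  refine ⟨W₁, ρ, hint, hnoeth, (D₁, ℓ) :: ℰ₁, 𝓔, hseq, hW₁, h𝓔, hprime, hirr, hne, fun p hp => ?_⟩
  obtain ⟨hc, hs, hq⟩ := hmem p hp
  exact ⟨hc, hU ▸ hs, hq⟩

/-- [OURS · L1 W5.2 · R5ᴴ N4] The same export with PRECONNECTED supports (the hypothesis shape of the PEEL loop N5
`…DepthHSepPeel`: an irreducible set is preconnected). [cite: Kollar2007, (3.111) Step 3] -/
theorem components_of_cjsB_preconnected (hCJS : CossartJannsenSaito2020EmbeddedSequenceB.{u}) (W : Scheme.{u})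
    [IsIntegral W] [IsNoetherian W] (hreg : Scheme.IsRegular W) (hexc : Scheme.IsExcellent W)
    (hdim : topologicalKrullDim W = 3) (D : W.IdealSheafData) (hD : IsEffectiveCartier D) (ℓ : ℕ) (hℓ : 1 ≤ ℓ) :
    ∃ (W₁ : Scheme.{u}) (ρ : W₁ ⟶ W) (_ : IsIntegral W₁) (_ : IsNoetherian W₁) (𝒟₁ : List (W₁.IdealSheafData × ℕ))
      (𝓔 : List W₁.IdealSheafData),
      HSepSeq ρ [(D, ℓ)] 𝒟₁ ∧ Scheme.IsRegular W₁ ∧ HasSNC 𝓔 ∧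
      (∀ T ∈ 𝓔, _root_.IsPreconnected (T.support : Set W₁)) ∧
      (∀ p ∈ 𝒟₁, ∃ q : List (W₁.IdealSheafData × ℕ), (∀ f ∈ q, f.1 ∈ 𝓔) ∧ p.1 = monomialIdeal q) := by
  obtain ⟨W₁, ρ, hint, hnoeth, 𝒟₁, 𝓔, hseq, hW₁, h𝓔, -, hirr, -, hmem⟩ :=
    components_of_cjsB hCJS W hreg hexc hdim D hD ℓ hℓ
  exact ⟨W₁, ρ, hint, hnoeth, 𝒟₁, 𝓔, hseq, hW₁, h𝓔, fun T hT => (hirr T hT).isConnected.isPreconnected,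
    fun p hp => (hmem p hp).2.2⟩

end HSepCJS

end Summit.ResolutionOfSingularities.ResolutionOfSingularities.Theorems

end
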